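import Summits.NavierStokesRegularity.NavierStokesRegularity.Theorems.HeredityFromTwoT.Negative.HeredityFromTwoTFalseOfNoSwirlRungT
import Summits.NavierStokesRegularity.FluidComputer.PalasekTowerGermHostIsometry
import Summits.NavierStokesRegularity.FluidComputer.PalasekTowerGermHostFreeRunStageAt

/-!
# A STERILE strict-slot profile with ONE free run meeting the first tuned window's letter gives
# `NoSwirlRungAtOneT` — hence `EpisodeBaseT` AND `¬ (HeredityAtOneT ∧ HeredityFromTwoT)` (the companion-free germ line
# feeds the refuters' decider K201)

Cell `ns-blowup`, seat `ns-blowup-ecbridge-3` (g12; D-0074 GROUP C «BRIDGE SUPPORT», lineage `host_preparation`).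
Route `PalasekTowerBreakdown` (rev 19): crux stmt-NavierStokesRegularity-20303 `EpisodeBaseT`, heredity pair 20304
`HeredityAtOneT` / 20305 `HeredityFromTwoT`. LABEL: E–C typing (KERNEL: theorems only; `--supports`
stmt-NavierStokesRegularity-20303). WHAT THIS IS NOT: not Navier–Stokes evidence — no profile, free run, stage or
design is exhibited; the route decls appear only as conclusions of conditionals whose hypothesis is ONE free run of a
sterile strict-slot profile meeting the letter; nothing registers and no census number moves.

## The statement (what destination (A⁺) of the STERILE-DOOR test would mean in the kernel, DIRECTOR-NS #74)

Let `U` be an AXISYMMETRIC SWIRL-FREE strict-slot profile at the rates `R` (`Germ.LevelZeroDataAt R U ρ`: smooth,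
divergence free, supported in `B̄(0, ρ)`, speed `≤ Y₀(R)` WITH EQUALITY attained, strain `≥ A₀(R)` somewhere, an
`N₀(R)`-core, and the STRICT first-order anchor test `0 < ⟪U x, accel 1 U x⟫` at every argmax of `‖U‖`) and let
`(v, q)` be ONE classical finite-energy FREE run (`ν = 1`) on `[1, τfirstAt R]` from `v 1 = U`, under the cap
`(5/3)Y₁(R) − η`, showing at `τfirstAt R` in `B̄(0, ρ)` the three level-`1` faces with margin `η > 0`. Then
`NoSwirlRungGAt R 1` (`palasekTowerBreakdown_noSwirlRungGAt_one_of_sterile_freeRun`): the registering design is the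
germ schedule of `U` ITSELF (datum `0`, force = the faded residual of the line germ — `PalasekTowerGermHostFreeRunStageAt`
exposes it), and that design is axisymmetric swirl-free by the isometry covariance of the germ host
(`PalasekTowerGermHostIsometry`: the Newtonian potential, the acceleration, the germ and its residual commute with
linear isometries). At `R = tuned`: `NoSwirlRungAtOneT`, hence (K201, `HeredityFromTwoTFalseOfNoSwirlRungT`)
**`EpisodeBaseT ∧ ¬ (HeredityAtOneT ∧ HeredityFromTwoT)`** (`palasekTowerBreakdown_episodeBaseT_and_not_heredity_pair_of_sterile_freeRun`).
Contrast: the READING-2 door (`palasekTowerBreakdown_episodeBaseT_of_(scaled_)mechanism_freeRun`) asks NO level-`0`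
face and NO anchor of the released slice but superposes a SWIRLING tame carrier, so it yields `EpisodeBaseT` only.

References: S. Palasek, arXiv:2605.13827 §3.3–§4 [cite: Palasek2026ElementaryModel, §4]; P. G. Lemarié-Rieusset (2016)
Thm 10.4 [cite: LemarieRieusset2016, Thm 10.4 (p. 285)]; A. J. Majda, A. L. Bertozzi (CUP 2002) §1.2 Prop. 1.1
[cite: MajdaBertozziCUP2002, §1.2 Prop. 1.1].
-/

noncomputable section

-- `Summit.<Summit>.<Problem>` is the tree's mandated summit-side namespace (CONVENTIONS §2); for this
-- single-conjunct summit the two coincide, so the duplicate is deliberate.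
set_option linter.dupNamespace false

namespace Summit.NavierStokesRegularity.NavierStokesRegularity.Theorems

open Set Function MeasureTheory Metric
open scoped ENNReal ContDiff RealInnerProductSpace
open Summit.NavierStokesRegularity.NavierStokesRegularity.Theses
open Summit.NavierStokesRegularity.FluidComputer.PalasekTowerClayBridge
open Summit.NavierStokesRegularity.FluidComputer.PalasekTowerClayBridge.Germ
open Summit.NavierStokesRegularity.HeredityFromTwoTNoSwirl
open Literature.Analysis.FluidPDE

/-- **A STERILE STRICT-SLOT PROFILE WITH ONE FREE RUN MEETING THE LETTER OF `R` GIVES `NoSwirlRungGAt R 1`.**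
`h : LevelZeroDataAt R U ρ` with `U` axisymmetric swirl-free, `hR : R.BoxNumerics c₃ r`, and ONE classical
finite-energy free run on `[1, τfirstAt R]` from `U` under `(5/3)Y₁(R) − η` showing the three level-`1` faces with margin
`η > 0` in `B̄(0, ρ)` ⟹ an axisymmetric swirl-free pinned rigid quiet design on `R` with a registered level-`1` stage.
[cite: Palasek2026ElementaryModel, §4] [cite: MajdaBertozziCUP2002, §1.2 Prop. 1.1] -/
theorem palasekTowerBreakdown_noSwirlRungGAt_one_of_sterile_freeRun {R : TowerRates}
    {U : EuclideanSpace ℝ (Fin 3) → EuclideanSpace ℝ (Fin 3)} {ρ : ℝ} (h : LevelZeroDataAt R U ρ)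
    (hax : IsAxisymmetric U) (hsw : HasNoSwirl U) {c₃ r : ℝ} (hR : R.BoxNumerics c₃ r)
    {v : ℝ → EuclideanSpace ℝ (Fin 3) → EuclideanSpace ℝ (Fin 3)} {q : ℝ → EuclideanSpace ℝ (Fin 3) → ℝ}
    (hv : IsClassicalNSSolutionOn (Icc 1 (Host.τfirstAt R)) 1 0 v q) (hv1 : v 1 = U)
    (hvE : ∃ C : ℝ≥0∞, C < ⊤ ∧ ∀ t ∈ Icc (1 : ℝ) (Host.τfirstAt R), ∫⁻ x, ‖v t x‖ₑ ^ 2 ≤ C)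
    {η : ℝ} (hη : 0 < η)
    (hcap : ∀ t ∈ Icc (1 : ℝ) (Host.τfirstAt R), ∀ x, ‖v t x‖ ≤ 5 / 3 * R.Y 1 - η)
    (hspeed : ∃ x, ‖x‖ ≤ ρ ∧ R.Y 1 + η ≤ ‖v (Host.τfirstAt R) x‖)
    (hstrain : ∃ x, ‖x‖ ≤ ρ ∧ R.A 1 + η ≤ ‖fderiv ℝ (v (Host.τfirstAt R)) x‖)
    (hcore : ∃ (x : EuclideanSpace ℝ (Fin 3)) (γ : ℝ → EuclideanSpace ℝ (Fin 3)),
      ‖x‖ ≤ ρ ∧ ContDiff ℝ 1 γ ∧ γ 0 = γ 1 ∧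
      (∀ s ∈ Icc (0 : ℝ) 1, γ s ∈ closedBall x (1 / R.N 1)) ∧
      (∀ s ∈ Icc (0 : ℝ) 1, ‖deriv γ s‖ ≤ 8 * Real.pi / R.N 1) ∧
      R.N 1 ^ (R.β - 2) + η ≤ circulation (v (Host.τfirstAt R)) γ) :
    NoSwirlRungGAt R 1 := by
  obtain ⟨σ₀, ε, d, ⟨s⟩⟩ := h.exists_lineGerm_stageOne_of_freeRun hR hv hv1 hvE hη hcap hspeed hstrain hcore
  obtain ⟨hrig, hqu, hpins, -⟩ := d.schedule_facts hR
  exact ⟨d.schedule hR, hpins, hrig, hqu, d.schedule_axisym_noSwirl hR hax hsw, ⟨s⟩⟩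

/-- **At `tuned`: a sterile strict-slot profile with one free run meeting the first tuned window's letter inhabits
the mirrorT target class `NoSwirlRungAtOneT`.** [cite: Palasek2026ElementaryModel, §4] -/
theorem palasekTowerBreakdown_noSwirlRungAtOneT_of_sterile_freeRun
    {U : EuclideanSpace ℝ (Fin 3) → EuclideanSpace ℝ (Fin 3)} {ρ : ℝ} (h : LevelZeroDataAt TowerRates.tuned U ρ)
    (hax : IsAxisymmetric U) (hsw : HasNoSwirl U)
    {v : ℝ → EuclideanSpace ℝ (Fin 3) → EuclideanSpace ℝ (Fin 3)} {q : ℝ → EuclideanSpace ℝ (Fin 3) → ℝ}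
    (hv : IsClassicalNSSolutionOn (Icc 1 (Host.τfirstAt TowerRates.tuned)) 1 0 v q) (hv1 : v 1 = U)
    (hvE : ∃ C : ℝ≥0∞, C < ⊤ ∧ ∀ t ∈ Icc (1 : ℝ) (Host.τfirstAt TowerRates.tuned), ∫⁻ x, ‖v t x‖ₑ ^ 2 ≤ C)
    {η : ℝ} (hη : 0 < η)
    (hcap : ∀ t ∈ Icc (1 : ℝ) (Host.τfirstAt TowerRates.tuned), ∀ x, ‖v t x‖ ≤ 5 / 3 * TowerRates.tuned.Y 1 - η)
    (hspeed : ∃ x, ‖x‖ ≤ ρ ∧ TowerRates.tuned.Y 1 + η ≤ ‖v (Host.τfirstAt TowerRates.tuned) x‖)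
    (hstrain : ∃ x, ‖x‖ ≤ ρ ∧ TowerRates.tuned.A 1 + η ≤ ‖fderiv ℝ (v (Host.τfirstAt TowerRates.tuned)) x‖)
    (hcore : ∃ (x : EuclideanSpace ℝ (Fin 3)) (γ : ℝ → EuclideanSpace ℝ (Fin 3)),
      ‖x‖ ≤ ρ ∧ ContDiff ℝ 1 γ ∧ γ 0 = γ 1 ∧
      (∀ s ∈ Icc (0 : ℝ) 1, γ s ∈ closedBall x (1 / TowerRates.tuned.N 1)) ∧
      (∀ s ∈ Icc (0 : ℝ) 1, ‖deriv γ s‖ ≤ 8 * Real.pi / TowerRates.tuned.N 1) ∧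
      TowerRates.tuned.N 1 ^ (TowerRates.tuned.β - 2) + η ≤ circulation (v (Host.τfirstAt TowerRates.tuned)) γ) :
    NoSwirlRungAtOneT :=
  palasekTowerBreakdown_noSwirlRungGAt_one_of_sterile_freeRun h hax hsw TowerRates.tuned_boxNumerics hv hv1 hvE hη
    hcap hspeed hstrain hcore

/-- **… hence `EpisodeBaseT` AND the heredity PAIR is refuted** (K201 `not_noSwirlRungAtOneT_of_heredity_pair`): ONE
free run of a sterile strict-slot profile meeting the first tuned window's letter closes 20303 positively and
20304 ∧ 20305 negatively AS TYPED. [cite: LemarieRieusset2016, Thm 10.4 (p. 285)] [cite: Palasek2026ElementaryModel, §4] -/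
theorem palasekTowerBreakdown_episodeBaseT_and_not_heredity_pair_of_sterile_freeRun
    {U : EuclideanSpace ℝ (Fin 3) → EuclideanSpace ℝ (Fin 3)} {ρ : ℝ} (h : LevelZeroDataAt TowerRates.tuned U ρ)
    (hax : IsAxisymmetric U) (hsw : HasNoSwirl U)
    {v : ℝ → EuclideanSpace ℝ (Fin 3) → EuclideanSpace ℝ (Fin 3)} {q : ℝ → EuclideanSpace ℝ (Fin 3) → ℝ}
    (hv : IsClassicalNSSolutionOn (Icc 1 (Host.τfirstAt TowerRates.tuned)) 1 0 v q) (hv1 : v 1 = U)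
    (hvE : ∃ C : ℝ≥0∞, C < ⊤ ∧ ∀ t ∈ Icc (1 : ℝ) (Host.τfirstAt TowerRates.tuned), ∫⁻ x, ‖v t x‖ₑ ^ 2 ≤ C)
    {η : ℝ} (hη : 0 < η)
    (hcap : ∀ t ∈ Icc (1 : ℝ) (Host.τfirstAt TowerRates.tuned), ∀ x, ‖v t x‖ ≤ 5 / 3 * TowerRates.tuned.Y 1 - η)
    (hspeed : ∃ x, ‖x‖ ≤ ρ ∧ TowerRates.tuned.Y 1 + η ≤ ‖v (Host.τfirstAt TowerRates.tuned) x‖)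
    (hstrain : ∃ x, ‖x‖ ≤ ρ ∧ TowerRates.tuned.A 1 + η ≤ ‖fderiv ℝ (v (Host.τfirstAt TowerRates.tuned)) x‖)
    (hcore : ∃ (x : EuclideanSpace ℝ (Fin 3)) (γ : ℝ → EuclideanSpace ℝ (Fin 3)),
      ‖x‖ ≤ ρ ∧ ContDiff ℝ 1 γ ∧ γ 0 = γ 1 ∧
      (∀ s ∈ Icc (0 : ℝ) 1, γ s ∈ closedBall x (1 / TowerRates.tuned.N 1)) ∧
      (∀ s ∈ Icc (0 : ℝ) 1, ‖deriv γ s‖ ≤ 8 * Real.pi / TowerRates.tuned.N 1) ∧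
      TowerRates.tuned.N 1 ^ (TowerRates.tuned.β - 2) + η ≤ circulation (v (Host.τfirstAt TowerRates.tuned)) γ) :
    PalasekTowerBreakdown.EpisodeBaseT ∧
      ¬ (PalasekTowerBreakdown.HeredityAtOneT ∧ PalasekTowerBreakdown.HeredityFromTwoT) := by
  have hW : NoSwirlRungAtOneT :=
    palasekTowerBreakdown_noSwirlRungAtOneT_of_sterile_freeRun h hax hsw hv hv1 hvE hη hcap hspeed hstrain hcore
  refine ⟨?_, fun hp => not_noSwirlRungAtOneT_of_heredity_pair hp.1 hp.2 hW⟩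
  obtain ⟨S, hP, hRg, hQ, -, hs⟩ := hW
  exact ⟨S, hP, hRg, hQ, hs⟩

end Summit.NavierStokesRegularity.NavierStokesRegularity.Theorems

end
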